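import Literature.MathematicalPhysics.QuantumFieldTheory.Balaban1983to89.B9RWSums346MixedPair
import Literature.MathematicalPhysics.QuantumFieldTheory.Balaban1983to89.B9RWSums344InputFam

/-!
# `Balaban1983to89.B9RWSums344InputPair` — the (3.44)∕(3.45) members of [B9] for the sums G(U) of (3.107) and G′(U) of (3.90) on the
# DIRECTION-PAIR FAMILY ∇_{U,ν}G∇\*_{U,μ}: operator-level block-norm majorants per pair and for the package (def-Y's `e4`, `h2`)

T. Bałaban, *Propagators for lattice gauge theories in a background field*, Commun. Math. Phys. **99** (1985) 389–434
[`Balaban1985BackgroundPropagators`, "B9"], (3.44)–(3.45) p. 398, (3.39)–(3.40) p. 397 (*"max_{μ,ν}"*), (3.42) p. 397, Thm 3.7 (3.87)–(3.90)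
pp. 408–410, Thm 3.10 (3.105)–(3.108) pp. 414–416, p. 413; [4] = T. Bałaban, *Propagators and renormalization transformations for lattice
gauge theories. II*, Commun. Math. Phys. **96** (1984) 223–250 [`Balaban1984PropagatorsII`], (2.52)–(2.55) p. 232, Lemma 2.1 p. 234.

statement-level skeleton of published theorems with citation tags; proofs where landed; nothing here is a claim about the
Yang–Mills mass gap

WHY THIS FILE (this seat's located point (O4′), the (3.44)∕(3.45) half).  The sibling's `input3445_of_local310∕37` majorise the ONE-SLOT
composite `D ∘ₗ (G ∘ₗ Dstar)`, which at the record's coordinate pins carries only the diagonal direction pairs; def-Y's `kernelFamilyB.e4 ∕ .h2`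
take `⨆ ν, ⨆ μ`.  THIS FILE clones the sibling's engine PER DIRECTION PAIR on the letters of `B9RWSums346SecondDiff(Gp)` (∇_{U,ν} = `Dd U ν`,
∇\*_{U,μ} = `Dsd U μ`, endomorphisms of the X-lattice functions, so the input block-norm letter `bHX ε` lives on X-functions and the output is
probed by the X-probes `𝔭.ΦX`): ∇_νG∇\*_μ = Σ_□ ∇_ν(h_□G_□h_□)∇\*_μ + (∇_νG)(R∇\*_μ) ((3.106)∕(3.88) on the right), the input legs summed with N_I
(`InputLegsPair…`), the COMPONENT ∇_νG of the bundled (3.42) sup majorant (`B9RWSums346MixedPair.DirSup…`) resp. the component Φ^X_β∘∇_νG of the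
bundled (3.43) probe majorant (`DirSupHolder…`, a letter law), the factors R_a∇\*_μ from `bHX ε` summed with N_F ∕ N′ (`FactorsInputPair…`), and
the sibling's `tail_comp`.  Then the PACKAGE over P × P (`B9RWSums344InputFam.hasMaj_familyOp'`, `sliceProbe_comp_familyOp`): the model
`familyOp fun p => Dd p.1 ∘ₗ (G ∘ₗ Dsd p.2)` has the SAME majorants from `bHX ε` into the sharp blocks of `blk ∘ fst`, and its sliced probe
`sliceProbe (ΦX β)` into those of `blkPX ∘ fst` — the inputs of `B9RWSums344InputFam.lines3445_of_hasMaj_fam`.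
* §1 G side: `InputLegsPair310`, `FactorsInputPair310`, `DirSupHolder310`, ★ `inputPair3445_of_local310`, ★ `inputPair3445_family`;
* §2 G′ side: the twins `…37`, ★ `inputPair3445_of_local37`, ★ `inputPair3445_family_37`.

HONEST SCOPE.  Kernel bookkeeping; every operator-level input is a HYPOTHESIS SCHEMA of printed shape (Cor. 3.6's legs, the factors' bounds,
the component laws of the direction letters); the bundled (3.42) sup majorant of ∇_UG and the bundled (3.43) probe majorant of Φ_β∘∇_UG are
INPUTS (at the leaves: the pin's third datum and `holder343_of_local310∕37`); nothing of print asserted; NOT a node discharge; count-neutral;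
nothing continuum, nothing about the mass gap.  Cell `pub-ymgap` (HUMAN RULING D-0062), node N06 [B9], bundle F6, seat `pub-ymgap-dag-n06-k` (g8), 2026-08-27.
-/

namespace Literature.MathematicalPhysics.QuantumFieldTheory.Balaban1983to89.B9RWSums344InputPair

open Literature.MathematicalPhysics.QuantumFieldTheory.Balaban1983to89
open Finset B6RandomWalk B6RandomWalkHom B9Thm37Sum B9Thm34Ext B9Thm37Glue B9Thm37Whole B9Cor38Whole B9Thm310Whole
open B9RWSums343to347Whole B9RWSums346Schur B9Thm37GlueCor36 B9RWSums343Holder B9RWSums344Input B9RWSums344InputGp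
open B11SectG B9Thm37AllNorms B9Thm37AllNormsInstances B9SectDL2Decay B9RWSums346SecondDiff B9RWSums346SecondDiffGp B9RWSums346MixedPair
open B9RWSums344InputFam

noncomputable section

section Algebra

variable {X : Type}

/-- Algebra of (3.106)∕(3.88) read between a left member and an operator on the right. [folklore] -/
private theorem sandwich_split' {Z : Type} {E : (X → ℝ) →ₗ[ℝ] (Z → ℝ)} {Dst G G0 W : Module.End ℝ (X → ℝ)} (h : G = G0 + G * W) :
    E ∘ₗ (G ∘ₗ Dst) = E ∘ₗ (G0 ∘ₗ Dst) + (E ∘ₗ G) ∘ₗ (W ∘ₗ Dst) := by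
  conv_lhs => rw [h]
  apply LinearMap.ext
  intro f
  simp only [LinearMap.comp_apply, LinearMap.add_apply, Module.End.mul_apply, map_add]

/-- a left member distributes over a finite sum composed on the right. [folklore] -/
private theorem comp_sum_comp' {Z ι : Type} [Fintype ι] (E : (X → ℝ) →ₗ[ℝ] (Z → ℝ)) (Dst : Module.End ℝ (X → ℝ))
    (T : ι → Module.End ℝ (X → ℝ)) : E ∘ₗ ((∑ i, T i) ∘ₗ Dst) = ∑ i, E ∘ₗ (T i ∘ₗ Dst) := by
  apply LinearMap.ext
  intro f
  simp only [LinearMap.comp_apply, LinearMap.sum_apply, map_sum]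

/-- a finite sum of operators composed on the right. [folklore] -/
private theorem sum_comp'' {ι : Type} [Fintype ι] (Dst : Module.End ℝ (X → ℝ)) (T : ι → Module.End ℝ (X → ℝ)) :
    (∑ i, T i) ∘ₗ Dst = ∑ i, T i ∘ₗ Dst := by
  apply LinearMap.ext
  intro f
  simp only [LinearMap.comp_apply, LinearMap.sum_apply]

end Algebra

/-! ## §1 The sum G(U) of (3.107): letters, the (3.44)∕(3.45) majorants per direction pair, the package -/

section GSide

variable {g : B9.Geometry} [Fintype g.Site] [DecidableEq g.Site] {R : ℝ} {H : Prop} {B : B9.Backgrounds}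
variable {X Y ι A P PX PY : Type}

/-- **COROLLARY 3.6's INPUT-SIDE HÖLDER MEMBERS (3.44), (3.45) FOR THE HEAD TERMS h_□G_□(U)h_□ OF (3.107), LOCALIZED, PER DIRECTION PAIR**:
for 0 < ε ≦ 1, ∇_{U,ν}(h_□G_□h_□)∇\*_{U,μ} read from the input block norm `bHX ε` into the sharp blocks of X has the majorant 1_{S_I(□)}(y)·
B_I(ε)·e^{−δ₀d(y,y′)}; read through the X-probes Φ^X_β from `bHX (β+ε)`: 1_{S_I(□)}(y)·B_I(ε,β)·(Lʲη)^{−β}e^{−δ₀d(y,y′)}.  POSITED AS A WHOLE;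
a HYPOTHESIS SCHEMA, Corollary 3.6 is not asserted. [cite: Balaban1985BackgroundPropagators, Cor. 3.6 p.408 + (3.44)–(3.45) p.398 + (3.100) p.413] -/
structure InputLegsPair310 [Fintype X] [Fintype PX] (𝔬 : Ops310 g B X Y ι A) (𝔡 : DirOps310 𝔬 P) (𝔭 : HolderProbes g B X Y PX PY)
    (R : ℝ) (H : Prop) (bHX : ℝ → BlockNorm (toB6 g R H) (X → ℝ)) (SI : ι → Finset g.Site) (BI : ℝ → ℝ) (BI2 : ℝ → ℝ → ℝ)
    (δ₀ : ℝ) (U : B.Cfg) : Prop where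
  e4 : ∀ ε : ℝ, 0 < ε → ε ≤ 1 → ∀ (i : ι) (ν μ : P), HasMaj (bHX ε) (BlockNorm.ofBlocks (toB6 g R H) 𝔬.blk)
    (𝔡.Dd U ν ∘ₗ ((mulOp (𝔬.h i) * 𝔬.Gsq U i * mulOp (𝔬.h i)) ∘ₗ 𝔡.Dsd U μ))
    (fun (a b : g.Site) => (if a ∈ SI i then (1 : ℝ) else 0) * (BI ε * Real.exp (-(δ₀ * g.dist a b))))
  h2 : ∀ ε β : ℝ, 0 < ε → ε ≤ 1 → 0 ≤ β → β < 1 → ∀ (i : ι) (ν μ : P),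
    HasMaj (bHX (β + ε)) (BlockNorm.ofBlocks (toB6 g R H) 𝔭.blkPX)
    ((𝔭.ΦX U β ∘ₗ 𝔡.Dd U ν) ∘ₗ ((mulOp (𝔬.h i) * 𝔬.Gsq U i * mulOp (𝔬.h i)) ∘ₗ 𝔡.Dsd U μ))
    (fun (a b : g.Site) => (if a ∈ SI i then (1 : ℝ) else 0) * (BI2 ε β * g.len a ^ (-β) * Real.exp (-(δ₀ * g.dist a b))))

/-- **THE FACTORS R_a(U)∇\*_{U,μ} FROM THE INPUT HÖLDER NORM, PER DIRECTION** (p. 413; p. 398's convention on ∇ ∕ ∇\*): for every ε > 0,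
R_a∇\*_{U,μ} read from `bHX ε` into the sharp blocks has the majorant 1_{X∩𝔅}(y)·θ_I(ε)M⁻¹·(Lʲη)⁻¹·e^{−δ₀d(y,y′)}.  POSITED; a HYPOTHESIS SCHEMA.
[cite: Balaban1985BackgroundPropagators, p.413 + (3.105) p.414 + (3.44) p.398] -/
structure FactorsInputPair310 [Fintype X] (𝔬 : Ops310 g B X Y ι A) (𝔡 : DirOps310 𝔬 P) (R : ℝ) (H : Prop)
    (bHX : ℝ → BlockNorm (toB6 g R H) (X → ℝ)) (θI : ℝ → ℝ) (δ₀ : ℝ) (U : B.Cfg) : Prop where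
  facDs : ∀ ε : ℝ, 0 < ε → ∀ (a : A) (μ : P), HasMaj (bHX ε) (BlockNorm.ofBlocks (toB6 g R H) 𝔬.blk) (𝔬.Rf U a ∘ₗ 𝔡.Dsd U μ)
    (fun (y y' : g.Site) => (if y ∈ 𝔬.SF a then (1 : ℝ) else 0) *
      (θI ε * g.M⁻¹ * (g.len y)⁻¹ * Real.exp (-(δ₀ * g.dist y y'))))

/-- ★ **THE PROBED DIRECTION LETTERS ARE COMPONENTS OF THE PROBED BUNDLED ONE**: every (3.43)-type probe majorant of Φ^Y_β∘∇_UG (X-input,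
Y-probes) is a probe majorant of each Φ^X_β∘∇_{U,ν}G (X-input, X-probes) — at the record's pins the X- and Y-probes are the same Hölder
quotients slot by slot.  A HYPOTHESIS SCHEMA about the letters only. [cite: Balaban1985BackgroundPropagators, (3.43) p.398 + (3.40) p.397 + (3.5)–(3.8) p.392] -/
structure DirSupHolder310 [Fintype X] [Fintype PX] [Fintype PY] (𝔬 : Ops310 g B X Y ι A) (𝔡 : DirOps310 𝔬 P)
    (𝔭 : HolderProbes g B X Y PX PY) (R : ℝ) (H : Prop) (U : B.Cfg) : Prop where
  probe : ∀ (β : ℝ) (m : g.Site → g.Site → ℝ),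
    HasMajorantHom (g := toB6 g R H) 𝔬.blk 𝔭.blkPY ((𝔭.ΦY U β ∘ₗ 𝔬.D U) ∘ₗ 𝔬.G U) m →
      ∀ ν : P, HasMajorantHom (g := toB6 g R H) 𝔬.blk 𝔭.blkPX ((𝔭.ΦX U β ∘ₗ 𝔡.Dd U ν) ∘ₗ 𝔬.G U) m

/-- The factors R_a∇\*_μ from `bHX ε`, summed with N_F. [cite: Balaban1985BackgroundPropagators, p.413] -/
private theorem factorsPair_sum [Fintype X] [Fintype A] {𝔬 : Ops310 g B X Y ι A} {𝔡 : DirOps310 𝔬 P}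
    {bHX : ℝ → BlockNorm (toB6 g R H) (X → ℝ)} {θI : ℝ → ℝ} {δ₀ : ℝ} {U : B.Cfg} {NF ε : ℝ}
    (hFI : FactorsInputPair310 𝔬 𝔡 R H bHX θI δ₀ U) (hε : 0 < ε) (hθ : 0 ≤ θI ε * g.M⁻¹) (hlen : ∀ y : g.Site, 0 ≤ g.len y)
    (hcntF : ∀ a : g.Site, (∑ q, if a ∈ 𝔬.SF q then (1 : ℝ) else 0) ≤ NF) (μ : P) :
    HasMaj (bHX ε) (BlockNorm.ofBlocks (toB6 g R H) 𝔬.blk) ((∑ a, 𝔬.Rf U a) ∘ₗ 𝔡.Dsd U μ)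
      (fun (y y' : g.Site) => NF * (θI ε * g.M⁻¹) * (g.len y)⁻¹ * Real.exp (-(δ₀ * g.dist y y'))) := by
  rw [sum_comp'']
  have h := hasMaj_localSum (G := toB6 g R H) (fun a => 𝔬.Rf U a ∘ₗ 𝔡.Dsd U μ)
    (fun a (y : g.Site) => if y ∈ 𝔬.SF a then (1 : ℝ) else 0)
    (fun (y y' : g.Site) => θI ε * g.M⁻¹ * (g.len y)⁻¹ * Real.exp (-(δ₀ * g.dist y y'))) NF
    (fun y y' => mul_nonneg (mul_nonneg hθ (inv_nonneg.mpr (hlen y))) (Real.exp_nonneg _)) (fun a => hFI.facDs ε hε a μ) hcntF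
  exact h.mono fun y y' => le_of_eq (by ring)

/-- ★ **THE (3.44)∕(3.45) MEMBERS OF THE SUM G(U) OF (3.107), PER DIRECTION PAIR** — from (3.106) read as ∇_νG∇\*_μ = Σ_□ ∇_ν(h_□G_□h_□)∇\*_μ
+ (∇_νG)(R∇\*_μ): the input legs summed with N_I; the COMPONENT ∇_νG of the bundled (3.42) sup majorant C·Lʲη·e^{−δd} (`DirSup310.left`) resp.
the component Φ^X_β∘∇_νG of the bundled (3.43) probe majorant h_c(β)·(Lʲη)^{1−β}·e^{−δd} (`DirSupHolder310.probe`); the factors from `bHX`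
summed with N_F; `tail_comp`.  For 0 < ε ≦ 1 (and 0 ≦ β < 1): ∇_νG∇\*_μ : bHX(ε) → sharp blocks has the majorant `inputConst44 …`(ε)·
e^{−(1−α)δd}, and Φ^X_β∘∇_νG∇\*_μ : bHX(β+ε) → probe blocks has `inputConst45 … (h_c β) …`(ε,β)·(Lʲη)^{−β}e^{−(1−α)δd}.
[cite: Balaban1985BackgroundPropagators, Thm 3.10 (3.105)–(3.108) pp.414–416 + (3.44)–(3.45) p.398 + (3.42)–(3.43) pp.397–398 + p.413; Balaban1984PropagatorsII, (2.52)–(2.55) p.232 + Lemma 2.1 p.234] -/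
theorem inputPair3445_of_local310 [Fintype X] [DecidableEq X] [Fintype Y] [Fintype ι] [Fintype A] [Fintype PX] [Fintype PY]
    (𝔬 : Ops310 g B X Y ι A) (𝔡 : DirOps310 𝔬 P) (𝔭 : HolderProbes g B X Y PX PY) (R : ℝ) (H : Prop)
    (bHX : ℝ → BlockNorm (toB6 g R H) (X → ℝ)) (d d₁ : ℕ) (δ α L₀ δ₁ α₁ ρ N N' NF Cℓ NI C : ℝ) (κ : Sizes310)
    (SI : ι → Finset g.Site) (hc BI θI : ℝ → ℝ) (BI2 : ℝ → ℝ → ℝ) (U : B.Cfg)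
    (hδ₁ : 0 ≤ δ₁) (hα₁ : 0 ≤ α₁) (hNF : 0 ≤ NF) (hNI : 0 ≤ NI) (hM : 1 ≤ g.M) (hC : 0 ≤ C)
    (hδle : δ ≤ (1 - α₁) * δ₁) (hαδ : 0 ≤ α * δ) (hαδ1 : α * δ ≤ δ)
    (hs : StaticOK310 𝔬 ρ N N' NF Cℓ κ) (hcntI : ∀ a : g.Site, (∑ i, if a ∈ SI i then (1 : ℝ) else 0) ≤ NI)
    (hhc : ∀ β, 0 ≤ β → β < 1 → 0 ≤ hc β) (hBI : ∀ ε, 0 < ε → ε ≤ 1 → 0 ≤ BI ε)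
    (hBI2 : ∀ ε β, 0 < ε → ε ≤ 1 → 0 ≤ β → β < 1 → 0 ≤ BI2 ε β) (hθI : ∀ ε, 0 < ε → 0 ≤ θI ε)
    (h261 : Ineq261 d₁ (toB6 g R H) δ₁ α₁) (hF : Facts347 g R H d δ α L₀) (hi : Identities310 𝔬 R H U)
    (hIL : InputLegsPair310 𝔬 𝔡 𝔭 R H bHX SI BI BI2 δ₁ U) (hFI : FactorsInputPair310 𝔬 𝔡 R H bHX θI δ₁ U)
    (hDS : DirSup310 𝔬 𝔡 R H U) (hDH : DirSupHolder310 𝔬 𝔡 𝔭 R H U)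
    (h1 : HasMajorantHom (g := toB6 g R H) 𝔬.blk 𝔬.blkY (𝔬.D U ∘ₗ 𝔬.G U)
      (fun (a b : g.Site) => C * g.len a * Real.exp (-(δ * g.dist a b))))
    (hHol : ∀ β : ℝ, 0 ≤ β → β < 1 → HasMajorantHom (g := toB6 g R H) 𝔬.blk 𝔭.blkPY ((𝔭.ΦY U β ∘ₗ 𝔬.D U) ∘ₗ 𝔬.G U)
      (fun (a b : g.Site) => hc β * g.len a ^ (1 - β) * Real.exp (-(δ * g.dist a b)))) (ν μ : P) :
    (∀ ε : ℝ, 0 < ε → ε ≤ 1 → HasMaj (bHX ε) (BlockNorm.ofBlocks (toB6 g R H) 𝔬.blk) (𝔡.Dd U ν ∘ₗ (𝔬.G U ∘ₗ 𝔡.Dsd U μ))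
        (fun (a b : g.Site) => inputConst44 d₁ δ₁ α₁ NI NF C L₀ (BI ε) (θI ε) * Real.exp (-((1 - α) * δ * g.dist a b)))) ∧
      (∀ ε β : ℝ, 0 < ε → ε ≤ 1 → 0 ≤ β → β < 1 →
        HasMaj (bHX (β + ε)) (BlockNorm.ofBlocks (toB6 g R H) 𝔭.blkPX) (𝔭.ΦX U β ∘ₗ (𝔡.Dd U ν ∘ₗ (𝔬.G U ∘ₗ 𝔡.Dsd U μ)))
          (fun (a b : g.Site) => inputConst45 d₁ δ₁ α₁ NI NF L₀ (hc β) (BI2 ε β) (θI (β + ε)) * g.len a ^ (-β) *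
            Real.exp (-((1 - α) * δ * g.dist a b)))) := by
  -- adapted from the sibling's `B9RWSums344Input.input3445_of_local310` (one-slot model), per direction pair
  have hMpos : 0 < g.M := lt_of_lt_of_le one_pos hM
  have hMinv : g.M⁻¹ ≤ 1 := inv_le_one_of_one_le₀ hM
  have hMinv0 : 0 ≤ g.M⁻¹ := inv_nonneg.mpr hMpos.le
  have hlen0 : ∀ y : g.Site, 0 ≤ g.len y := fun y => (hs.lenpos y).le
  have htri : Triangle254 (toB6 g R H) := fun a b c => hs.tri a b c
  have hc1 : 0 ≤ B6.c1 d₁ δ₁ α₁ := c1_nonneg d₁ δ₁ α₁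
  have hL₀ : 0 ≤ L₀ := le_trans (le_trans zero_le_one hF.one_le_L) hF.L_le
  have hαδ₁ : 0 ≤ α₁ * δ₁ := mul_nonneg hα₁ hδ₁
  have hrate : (1 - α) * δ ≤ (1 - α₁) * δ₁ := by nlinarith [hαδ, hδle]
  have hexp : ∀ a b : g.Site, Real.exp (-(δ₁ * g.dist a b)) ≤ Real.exp (-((1 - α) * δ * g.dist a b)) := fun a b =>
    Real.exp_le_exp.mpr (neg_le_neg (mul_le_mul_of_nonneg_right (by nlinarith [hrate, hαδ₁]) (hs.dnn a b)))
  have hfix : 𝔬.G U = (∑ i, mulOp (𝔬.h i) * 𝔬.Gsq U i * mulOp (𝔬.h i)) + 𝔬.G U * ∑ a, 𝔬.Rf U a :=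
    fixedPoint_of_388 hi.inv hi.eq3105
  refine ⟨fun ε hε0 hε1 => ?_, fun ε β hε0 hε1 hβ0 hβ1 => ?_⟩
  · -- (3.44), pair (ν, μ): ∇_νG∇*_μ = Σ ∇_ν(hGh)∇*_μ + (∇_νG)(R∇*_μ)
    have hθ : 0 ≤ θI ε * g.M⁻¹ := mul_nonneg (hθI ε hε0) hMinv0
    have hP := factorsPair_sum hFI hε0 hθ hlen0 hs.cntF μ
    have hS : HasMajorantHom (g := toB6 g R H) 𝔬.blk 𝔬.blk (𝔡.Dd U ν ∘ₗ 𝔬.G U)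
        (fun (a b : g.Site) => C * (g.len a ^ (0 : ℝ) * g.len a) * Real.exp (-(δ * g.dist a b))) :=
      hasMajorantHom_mono (g := toB6 g R H) 𝔬.blk 𝔬.blk (hDS.left _ h1 ν) fun a b => le_of_eq (by rw [Real.rpow_zero, one_mul])
    have htail := tail_comp (bHX ε) 𝔬.blk 𝔬.blk hF h261 htri hs.symm hs.dnn hs.lenpos hC (mul_nonneg hNF hθ) hαδ1 hrate hS hP
    have hhead := hasMaj_localSum (G := toB6 g R H)
      (fun i => 𝔡.Dd U ν ∘ₗ ((mulOp (𝔬.h i) * 𝔬.Gsq U i * mulOp (𝔬.h i)) ∘ₗ 𝔡.Dsd U μ))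
      (fun i (a : g.Site) => if a ∈ SI i then (1 : ℝ) else 0)
      (fun (a b : g.Site) => BI ε * Real.exp (-(δ₁ * g.dist a b))) NI
      (fun a b => mul_nonneg (hBI ε hε0 hε1) (Real.exp_nonneg _)) (fun i => hIL.e4 ε hε0 hε1 i ν μ) hcntI
    rw [sandwich_split' hfix, comp_sum_comp']
    refine (hhead.add htail).mono fun a b => ?_
    have hK0 : 0 ≤ NI * BI ε := mul_nonneg hNI (hBI ε hε0 hε1)
    have ht : C * (NF * (θI ε * g.M⁻¹)) * L₀ * B6.c1 d₁ δ₁ α₁ ≤ C * (NF * θI ε) * L₀ * B6.c1 d₁ δ₁ α₁ := by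
      have h3 : θI ε * g.M⁻¹ ≤ θI ε := by
        calc θI ε * g.M⁻¹ ≤ θI ε * 1 := mul_le_mul_of_nonneg_left hMinv (hθI ε hε0)
          _ = θI ε := mul_one _
      have h4 : C * (NF * (θI ε * g.M⁻¹)) ≤ C * (NF * θI ε) :=
        mul_le_mul_of_nonneg_left (mul_le_mul_of_nonneg_left h3 hNF) hC
      exact mul_le_mul_of_nonneg_right (mul_le_mul_of_nonneg_right h4 hL₀) hc1
    calc NI * (BI ε * Real.exp (-(δ₁ * g.dist a b))) +
          C * (NF * (θI ε * g.M⁻¹)) * L₀ * B6.c1 d₁ δ₁ α₁ * g.len a ^ (0 : ℝ) * Real.exp (-((1 - α) * δ * g.dist a b))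
        = NI * BI ε * Real.exp (-(δ₁ * g.dist a b)) +
          C * (NF * (θI ε * g.M⁻¹)) * L₀ * B6.c1 d₁ δ₁ α₁ * Real.exp (-((1 - α) * δ * g.dist a b)) := by
          rw [Real.rpow_zero]; ring
      _ ≤ NI * BI ε * Real.exp (-((1 - α) * δ * g.dist a b)) +
          C * (NF * θI ε) * L₀ * B6.c1 d₁ δ₁ α₁ * Real.exp (-((1 - α) * δ * g.dist a b)) :=
          add_le_add (mul_le_mul_of_nonneg_left (hexp a b) hK0) (mul_le_mul_of_nonneg_right ht (Real.exp_nonneg _))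
      _ = inputConst44 d₁ δ₁ α₁ NI NF C L₀ (BI ε) (θI ε) * Real.exp (-((1 - α) * δ * g.dist a b)) := by
          unfold inputConst44; ring
  · -- (3.45), pair (ν, μ): Φ∇_νG∇*_μ = Σ Φ∇_ν(hGh)∇*_μ + (Φ∇_νG)(R∇*_μ)
    have hβε : 0 < β + ε := by linarith
    have hθ : 0 ≤ θI (β + ε) * g.M⁻¹ := mul_nonneg (hθI (β + ε) hβε) hMinv0
    have hP := factorsPair_sum hFI hβε hθ hlen0 hs.cntF μ
    have hHK : 0 ≤ hc β := hhc β hβ0 hβ1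
    have hS : HasMajorantHom (g := toB6 g R H) 𝔬.blk 𝔭.blkPX ((𝔭.ΦX U β ∘ₗ 𝔡.Dd U ν) ∘ₗ 𝔬.G U)
        (fun (a b : g.Site) => hc β * (g.len a ^ (-β) * g.len a) * Real.exp (-(δ * g.dist a b))) := by
      refine hasMajorantHom_mono (g := toB6 g R H) 𝔬.blk 𝔭.blkPX (hDH.probe β _ (hHol β hβ0 hβ1) ν) fun a b => le_of_eq ?_
      have hr : g.len a ^ (1 - β) = g.len a ^ (-β) * g.len a := by
        rw [show (1 - β : ℝ) = -β + 1 by ring, Real.rpow_add (hs.lenpos a), Real.rpow_one]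
      rw [hr]
    have htail := tail_comp (bHX (β + ε)) 𝔬.blk 𝔭.blkPX hF h261 htri hs.symm hs.dnn hs.lenpos hHK (mul_nonneg hNF hθ) hαδ1
      hrate hS hP
    have hhead := hasMaj_localSum (G := toB6 g R H)
      (fun i => (𝔭.ΦX U β ∘ₗ 𝔡.Dd U ν) ∘ₗ ((mulOp (𝔬.h i) * 𝔬.Gsq U i * mulOp (𝔬.h i)) ∘ₗ 𝔡.Dsd U μ))
      (fun i (a : g.Site) => if a ∈ SI i then (1 : ℝ) else 0)
      (fun (a b : g.Site) => BI2 ε β * g.len a ^ (-β) * Real.exp (-(δ₁ * g.dist a b))) NI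
      (fun a b => mul_nonneg (mul_nonneg (hBI2 ε β hε0 hε1 hβ0 hβ1) (Real.rpow_nonneg (hlen0 a) _)) (Real.exp_nonneg _))
      (fun i => hIL.h2 ε β hε0 hε1 hβ0 hβ1 i ν μ) hcntI
    have hassoc : 𝔭.ΦX U β ∘ₗ (𝔡.Dd U ν ∘ₗ (𝔬.G U ∘ₗ 𝔡.Dsd U μ)) = (𝔭.ΦX U β ∘ₗ 𝔡.Dd U ν) ∘ₗ (𝔬.G U ∘ₗ 𝔡.Dsd U μ) := by
      rw [LinearMap.comp_assoc]
    rw [hassoc, sandwich_split' hfix, comp_sum_comp']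
    refine (hhead.add htail).mono fun a b => ?_
    have hW : 0 ≤ g.len a ^ (-β) := Real.rpow_nonneg (hlen0 a) _
    have hK0 : 0 ≤ NI * BI2 ε β * g.len a ^ (-β) := mul_nonneg (mul_nonneg hNI (hBI2 ε β hε0 hε1 hβ0 hβ1)) hW
    have ht : hc β * (NF * (θI (β + ε) * g.M⁻¹)) * L₀ * B6.c1 d₁ δ₁ α₁ ≤ hc β * (NF * θI (β + ε)) * L₀ * B6.c1 d₁ δ₁ α₁ := by
      have h3 : θI (β + ε) * g.M⁻¹ ≤ θI (β + ε) := by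
        calc θI (β + ε) * g.M⁻¹ ≤ θI (β + ε) * 1 := mul_le_mul_of_nonneg_left hMinv (hθI (β + ε) hβε)
          _ = θI (β + ε) := mul_one _
      have h4 : hc β * (NF * (θI (β + ε) * g.M⁻¹)) ≤ hc β * (NF * θI (β + ε)) :=
        mul_le_mul_of_nonneg_left (mul_le_mul_of_nonneg_left h3 hNF) hHK
      exact mul_le_mul_of_nonneg_right (mul_le_mul_of_nonneg_right h4 hL₀) hc1
    calc NI * (BI2 ε β * g.len a ^ (-β) * Real.exp (-(δ₁ * g.dist a b))) +
          hc β * (NF * (θI (β + ε) * g.M⁻¹)) * L₀ * B6.c1 d₁ δ₁ α₁ * g.len a ^ (-β) * Real.exp (-((1 - α) * δ * g.dist a b))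
        = NI * BI2 ε β * g.len a ^ (-β) * Real.exp (-(δ₁ * g.dist a b)) +
          hc β * (NF * (θI (β + ε) * g.M⁻¹)) * L₀ * B6.c1 d₁ δ₁ α₁ * (g.len a ^ (-β) * Real.exp (-((1 - α) * δ * g.dist a b))) := by
          ring
      _ ≤ NI * BI2 ε β * g.len a ^ (-β) * Real.exp (-((1 - α) * δ * g.dist a b)) +
          hc β * (NF * θI (β + ε)) * L₀ * B6.c1 d₁ δ₁ α₁ * (g.len a ^ (-β) * Real.exp (-((1 - α) * δ * g.dist a b))) :=
          add_le_add (mul_le_mul_of_nonneg_left (hexp a b) hK0)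
            (mul_le_mul_of_nonneg_right ht (mul_nonneg hW (Real.exp_nonneg _)))
      _ = inputConst45 d₁ δ₁ α₁ NI NF L₀ (hc β) (BI2 ε β) (θI (β + ε)) * g.len a ^ (-β) *
            Real.exp (-((1 - α) * δ * g.dist a b)) := by
          unfold inputConst45; ring

variable [Fintype P]

/-- ★ **THE PACKAGED FAMILY ∇_{U,ν}G∇\*_{U,μ} OVER P × P HAS THE SAME (3.44)∕(3.45) MAJORANTS** from `bHX` into the sharp blocks of
`blk ∘ fst` resp., through the sliced X-probes, into those of `blkPX ∘ fst` (sup sizes: no |P| factor) — the inputs `h44`, `h45` of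
`B9RWSums344InputFam.lines3445_of_hasMaj_fam` for the model of def-Y's `e4`, `h2` at the coordinate pins.
[cite: Balaban1985BackgroundPropagators, (3.44)–(3.45) p.398 + (3.39) p.397 («max_{μ,ν}»)] -/
theorem inputPair3445_family [Fintype X] [DecidableEq X] [Fintype Y] [Fintype ι] [Fintype A] [Fintype PX] [Fintype PY]
    (𝔬 : Ops310 g B X Y ι A) (𝔡 : DirOps310 𝔬 P) (𝔭 : HolderProbes g B X Y PX PY) (R : ℝ) (H : Prop)
    (bHX : ℝ → BlockNorm (toB6 g R H) (X → ℝ)) (d d₁ : ℕ) (δ α L₀ δ₁ α₁ ρ N N' NF Cℓ NI C : ℝ) (κ : Sizes310)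
    (SI : ι → Finset g.Site) (hc BI θI : ℝ → ℝ) (BI2 : ℝ → ℝ → ℝ) (U : B.Cfg)
    (hδ₁ : 0 ≤ δ₁) (hα₁ : 0 ≤ α₁) (hNF : 0 ≤ NF) (hNI : 0 ≤ NI) (hM : 1 ≤ g.M) (hC : 0 ≤ C)
    (hδle : δ ≤ (1 - α₁) * δ₁) (hαδ : 0 ≤ α * δ) (hαδ1 : α * δ ≤ δ)
    (hs : StaticOK310 𝔬 ρ N N' NF Cℓ κ) (hcntI : ∀ a : g.Site, (∑ i, if a ∈ SI i then (1 : ℝ) else 0) ≤ NI)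
    (hhc : ∀ β, 0 ≤ β → β < 1 → 0 ≤ hc β) (hBI : ∀ ε, 0 < ε → ε ≤ 1 → 0 ≤ BI ε)
    (hBI2 : ∀ ε β, 0 < ε → ε ≤ 1 → 0 ≤ β → β < 1 → 0 ≤ BI2 ε β) (hθI : ∀ ε, 0 < ε → 0 ≤ θI ε)
    (h261 : Ineq261 d₁ (toB6 g R H) δ₁ α₁) (hF : Facts347 g R H d δ α L₀) (hi : Identities310 𝔬 R H U)
    (hIL : InputLegsPair310 𝔬 𝔡 𝔭 R H bHX SI BI BI2 δ₁ U) (hFI : FactorsInputPair310 𝔬 𝔡 R H bHX θI δ₁ U)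
    (hDS : DirSup310 𝔬 𝔡 R H U) (hDH : DirSupHolder310 𝔬 𝔡 𝔭 R H U)
    (h1 : HasMajorantHom (g := toB6 g R H) 𝔬.blk 𝔬.blkY (𝔬.D U ∘ₗ 𝔬.G U)
      (fun (a b : g.Site) => C * g.len a * Real.exp (-(δ * g.dist a b))))
    (hHol : ∀ β : ℝ, 0 ≤ β → β < 1 → HasMajorantHom (g := toB6 g R H) 𝔬.blk 𝔭.blkPY ((𝔭.ΦY U β ∘ₗ 𝔬.D U) ∘ₗ 𝔬.G U)
      (fun (a b : g.Site) => hc β * g.len a ^ (1 - β) * Real.exp (-(δ * g.dist a b)))) :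
    (∀ ε : ℝ, 0 < ε → ε ≤ 1 → HasMaj (bHX ε) (BlockNorm.ofBlocks (toB6 g R H) (𝔬.blk ∘ Prod.fst))
        (familyOp fun p : P × P => 𝔡.Dd U p.1 ∘ₗ (𝔬.G U ∘ₗ 𝔡.Dsd U p.2))
        (fun (a b : g.Site) => inputConst44 d₁ δ₁ α₁ NI NF C L₀ (BI ε) (θI ε) * Real.exp (-((1 - α) * δ * g.dist a b)))) ∧
      (∀ ε β : ℝ, 0 < ε → ε ≤ 1 → 0 ≤ β → β < 1 →
        HasMaj (bHX (β + ε)) (BlockNorm.ofBlocks (toB6 g R H) (𝔭.blkPX ∘ Prod.fst))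
          (sliceProbe (𝔭.ΦX U β) ∘ₗ familyOp fun p : P × P => 𝔡.Dd U p.1 ∘ₗ (𝔬.G U ∘ₗ 𝔡.Dsd U p.2))
          (fun (a b : g.Site) => inputConst45 d₁ δ₁ α₁ NI NF L₀ (hc β) (BI2 ε β) (θI (β + ε)) * g.len a ^ (-β) *
            Real.exp (-((1 - α) * δ * g.dist a b)))) := by
  have hL₀ : 0 ≤ L₀ := le_trans (le_trans zero_le_one hF.one_le_L) hF.L_le
  have hc1 : 0 ≤ B6.c1 d₁ δ₁ α₁ := c1_nonneg d₁ δ₁ α₁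
  have hlen0 : ∀ y : g.Site, 0 ≤ g.len y := fun y => (hs.lenpos y).le
  have hpair := fun p : P × P => inputPair3445_of_local310 𝔬 𝔡 𝔭 R H bHX d d₁ δ α L₀ δ₁ α₁ ρ N N' NF Cℓ NI C κ SI hc BI θI BI2
    U hδ₁ hα₁ hNF hNI hM hC hδle hαδ hαδ1 hs hcntI hhc hBI hBI2 hθI h261 hF hi hIL hFI hDS hDH h1 hHol p.1 p.2
  refine ⟨fun ε hε0 hε1 => ?_, fun ε β hε0 hε1 hβ0 hβ1 => ?_⟩
  · have hK : ∀ a b : g.Site, 0 ≤ inputConst44 d₁ δ₁ α₁ NI NF C L₀ (BI ε) (θI ε) * Real.exp (-((1 - α) * δ * g.dist a b)) := by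
      intro a b
      have h1' := hBI ε hε0 hε1
      have h2' := hθI ε hε0
      unfold inputConst44
      positivity
    exact hasMaj_familyOp' (R := R) (H := H) 𝔬.blk hK fun p => (hpair p).1 ε hε0 hε1
  · have hK : ∀ a b : g.Site, 0 ≤ inputConst45 d₁ δ₁ α₁ NI NF L₀ (hc β) (BI2 ε β) (θI (β + ε)) * g.len a ^ (-β) *
        Real.exp (-((1 - α) * δ * g.dist a b)) := by
      intro a b
      have h1' := hBI2 ε β hε0 hε1 hβ0 hβ1
      have h2' := hθI (β + ε) (by linarith)
      have h3' := hhc β hβ0 hβ1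
      have h4' : 0 ≤ g.len a ^ (-β) := Real.rpow_nonneg (hlen0 a) _
      unfold inputConst45
      positivity
    rw [sliceProbe_comp_familyOp]
    exact hasMaj_familyOp' (R := R) (H := H) 𝔭.blkPX hK fun p => (hpair p).2 ε β hε0 hε1 hβ0 hβ1

end GSide

/-! ## §2 The sum G′(U) of (3.90): the twins -/

section GpSide

variable {g : B9.Geometry} [Fintype g.Site] [DecidableEq g.Site] {R : ℝ} {H : Prop} {B : B9.Backgrounds}
variable {X Y ι P PX PY : Type}

/-- the G′ twin of `InputLegsPair310`: Corollary 3.6's (3.44)∕(3.45) members for the head terms h_□G′_□(U)h_□ of (3.90), per direction pair.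
POSITED AS A WHOLE; a HYPOTHESIS SCHEMA. [cite: Balaban1985BackgroundPropagators, Cor. 3.6 p.408 + (3.87) p.409 + (3.44)–(3.45) p.398] -/
structure InputLegsPair37 [Fintype X] [Fintype PX] (𝔬 : Ops g B X Y ι) (𝔡 : DirOps37 𝔬 P) (𝔭 : HolderProbes g B X Y PX PY)
    (R : ℝ) (H : Prop) (bHX : ℝ → BlockNorm (toB6 g R H) (X → ℝ)) (SI : ι → Finset g.Site) (BI : ℝ → ℝ) (BI2 : ℝ → ℝ → ℝ)
    (δ₀ : ℝ) (U : B.Cfg) : Prop where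
  e4 : ∀ ε : ℝ, 0 < ε → ε ≤ 1 → ∀ (i : ι) (ν μ : P), HasMaj (bHX ε) (BlockNorm.ofBlocks (toB6 g R H) 𝔬.blk)
    (𝔡.Dd U ν ∘ₗ ((mulOp (𝔬.h i) * 𝔬.Gsq U i * mulOp (𝔬.h i)) ∘ₗ 𝔡.Dsd U μ))
    (fun (a b : g.Site) => (if a ∈ SI i then (1 : ℝ) else 0) * (BI ε * Real.exp (-(δ₀ * g.dist a b))))
  h2 : ∀ ε β : ℝ, 0 < ε → ε ≤ 1 → 0 ≤ β → β < 1 → ∀ (i : ι) (ν μ : P),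
    HasMaj (bHX (β + ε)) (BlockNorm.ofBlocks (toB6 g R H) 𝔭.blkPX)
    ((𝔭.ΦX U β ∘ₗ 𝔡.Dd U ν) ∘ₗ ((mulOp (𝔬.h i) * 𝔬.Gsq U i * mulOp (𝔬.h i)) ∘ₗ 𝔡.Dsd U μ))
    (fun (a b : g.Site) => (if a ∈ SI i then (1 : ℝ) else 0) * (BI2 ε β * g.len a ^ (-β) * Real.exp (-(δ₀ * g.dist a b))))

/-- the G′ twin of `FactorsInputPair310`: the terms (P_□∇_U + C_□)G′_□h_□∇\*_{U,μ} of R′∇\*_μ from `bHX ε`, majorant 1_{S′_□}(y)·θ_I(ε)·(Lʲη)⁻¹·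
e^{−δ₀d}.  POSITED; a HYPOTHESIS SCHEMA. [cite: Balaban1985BackgroundPropagators, (3.88)–(3.89) p.409 + (3.44) p.398] -/
structure FactorsInputPair37 [Fintype X] (𝔬 : Ops g B X Y ι) (𝔡 : DirOps37 𝔬 P) (R : ℝ) (H : Prop)
    (bHX : ℝ → BlockNorm (toB6 g R H) (X → ℝ)) (θI : ℝ → ℝ) (δ₀ : ℝ) (U : B.Cfg) : Prop where
  facDs : ∀ ε : ℝ, 0 < ε → ∀ (i : ι) (μ : P), HasMaj (bHX ε) (BlockNorm.ofBlocks (toB6 g R H) 𝔬.blk)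
    (((𝔬.P U i ∘ₗ 𝔬.D U + 𝔬.Cop U i) * 𝔬.Gsq U i * mulOp (𝔬.h i)) ∘ₗ 𝔡.Dsd U μ)
    (fun (y y' : g.Site) => (if y ∈ 𝔬.S' i then (1 : ℝ) else 0) * (θI ε * (g.len y)⁻¹ * Real.exp (-(δ₀ * g.dist y y'))))

/-- the G′ twin of `DirSupHolder310`.  A HYPOTHESIS SCHEMA about the letters only. [cite: Balaban1985BackgroundPropagators, (3.43) p.398 + (3.40) p.397] -/
structure DirSupHolder37 [Fintype X] [Fintype PX] [Fintype PY] (𝔬 : Ops g B X Y ι) (𝔡 : DirOps37 𝔬 P)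
    (𝔭 : HolderProbes g B X Y PX PY) (R : ℝ) (H : Prop) (U : B.Cfg) : Prop where
  probe : ∀ (β : ℝ) (m : g.Site → g.Site → ℝ),
    HasMajorantHom (g := toB6 g R H) 𝔬.blk 𝔭.blkPY ((𝔭.ΦY U β ∘ₗ 𝔬.D U) ∘ₗ 𝔬.Gp U) m →
      ∀ ν : P, HasMajorantHom (g := toB6 g R H) 𝔬.blk 𝔭.blkPX ((𝔭.ΦX U β ∘ₗ 𝔡.Dd U ν) ∘ₗ 𝔬.Gp U) m

/-- The terms of R′∇\*_μ from `bHX ε`, summed with N′. [cite: Balaban1985BackgroundPropagators, (3.88)–(3.89) p.409] -/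
private theorem factorsPair37_sum [Fintype X] [Fintype ι] {𝔬 : Ops g B X Y ι} {𝔡 : DirOps37 𝔬 P}
    {bHX : ℝ → BlockNorm (toB6 g R H) (X → ℝ)} {θI : ℝ → ℝ} {δ₀ : ℝ} {U : B.Cfg} {N' ε : ℝ}
    (hFI : FactorsInputPair37 𝔬 𝔡 R H bHX θI δ₀ U) (hε : 0 < ε) (hθ : 0 ≤ θI ε) (hlen : ∀ y : g.Site, 0 ≤ g.len y)
    (hcnt' : ∀ a : g.Site, (∑ i, if a ∈ 𝔬.S' i then (1 : ℝ) else 0) ≤ N') (μ : P) :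
    HasMaj (bHX ε) (BlockNorm.ofBlocks (toB6 g R H) 𝔬.blk)
      ((∑ i, (𝔬.P U i ∘ₗ 𝔬.D U + 𝔬.Cop U i) * 𝔬.Gsq U i * mulOp (𝔬.h i)) ∘ₗ 𝔡.Dsd U μ)
      (fun (y y' : g.Site) => N' * θI ε * (g.len y)⁻¹ * Real.exp (-(δ₀ * g.dist y y'))) := by
  rw [sum_comp'']
  have h := hasMaj_localSum (G := toB6 g R H)
    (fun i => ((𝔬.P U i ∘ₗ 𝔬.D U + 𝔬.Cop U i) * 𝔬.Gsq U i * mulOp (𝔬.h i)) ∘ₗ 𝔡.Dsd U μ)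
    (fun i (y : g.Site) => if y ∈ 𝔬.S' i then (1 : ℝ) else 0)
    (fun (y y' : g.Site) => θI ε * (g.len y)⁻¹ * Real.exp (-(δ₀ * g.dist y y'))) N'
    (fun y y' => mul_nonneg (mul_nonneg hθ (inv_nonneg.mpr (hlen y))) (Real.exp_nonneg _)) (fun i => hFI.facDs ε hε i μ) hcnt'
  exact h.mono fun y y' => le_of_eq (by ring)

/-- ★ **THE (3.44)∕(3.45) MEMBERS OF THE SUM G′(U) OF (3.90), PER DIRECTION PAIR** — (3.88) G′ = G′₀ + G′R′ read between ∇_ν and ∇\*_μ; the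
input legs summed with N_I; the component ∇_νG′ of the bundled (3.42) sup majorant resp. the component Φ^X_β∘∇_νG′ of the bundled (3.43) probe
majorant; the terms of R′∇\*_μ from `bHX` summed with N′; `tail_comp`.  Constants `inputConst44 d₁ δ₁ α₁ N_I N′ C L₀ …`, `inputConst45 … (h_c β) …`.
[cite: Balaban1985BackgroundPropagators, Thm 3.7 (3.87)–(3.90) pp.408–410 + (3.44)–(3.45) p.398 + (3.42)–(3.43) pp.397–398; Balaban1984PropagatorsII, (2.52)–(2.55) p.232 + Lemma 2.1 p.234] -/
theorem inputPair3445_of_local37 [Fintype X] [DecidableEq X] [Fintype Y] [Fintype ι] [Fintype PX] [Fintype PY]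
    (𝔬 : Ops g B X Y ι) (𝔡 : DirOps37 𝔬 P) (𝔭 : HolderProbes g B X Y PX PY) (R : ℝ) (H : Prop)
    (bHX : ℝ → BlockNorm (toB6 g R H) (X → ℝ)) (d d₁ : ℕ) (δ α L₀ δ₁ α₁ ρ N N' Cℓ NI C : ℝ) (κ : Sizes)
    (SI : ι → Finset g.Site) (hc BI θI : ℝ → ℝ) (BI2 : ℝ → ℝ → ℝ) (U : B.Cfg)
    (hδ₁ : 0 ≤ δ₁) (hα₁ : 0 ≤ α₁) (hN' : 0 ≤ N') (hNI : 0 ≤ NI) (hC : 0 ≤ C)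
    (hδle : δ ≤ (1 - α₁) * δ₁) (hαδ : 0 ≤ α * δ) (hαδ1 : α * δ ≤ δ)
    (hs : StaticOK 𝔬 ρ N N' Cℓ κ) (hcntI : ∀ a : g.Site, (∑ i, if a ∈ SI i then (1 : ℝ) else 0) ≤ NI)
    (hhc : ∀ β, 0 ≤ β → β < 1 → 0 ≤ hc β) (hBI : ∀ ε, 0 < ε → ε ≤ 1 → 0 ≤ BI ε)
    (hBI2 : ∀ ε β, 0 < ε → ε ≤ 1 → 0 ≤ β → β < 1 → 0 ≤ BI2 ε β) (hθI : ∀ ε, 0 < ε → 0 ≤ θI ε)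
    (h261 : Ineq261 d₁ (toB6 g R H) δ₁ α₁) (hF : Facts347 g R H d δ α L₀) (hi : Identities 𝔬 R H U)
    (hIL : InputLegsPair37 𝔬 𝔡 𝔭 R H bHX SI BI BI2 δ₁ U) (hFI : FactorsInputPair37 𝔬 𝔡 R H bHX θI δ₁ U)
    (hDS : DirSup37 𝔬 𝔡 R H U) (hDH : DirSupHolder37 𝔬 𝔡 𝔭 R H U)
    (h1 : HasMajorantHom (g := toB6 g R H) 𝔬.blk 𝔬.blkY (𝔬.D U ∘ₗ 𝔬.Gp U)
      (fun (a b : g.Site) => C * g.len a * Real.exp (-(δ * g.dist a b))))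
    (hHol : ∀ β : ℝ, 0 ≤ β → β < 1 → HasMajorantHom (g := toB6 g R H) 𝔬.blk 𝔭.blkPY ((𝔭.ΦY U β ∘ₗ 𝔬.D U) ∘ₗ 𝔬.Gp U)
      (fun (a b : g.Site) => hc β * g.len a ^ (1 - β) * Real.exp (-(δ * g.dist a b)))) (ν μ : P) :
    (∀ ε : ℝ, 0 < ε → ε ≤ 1 → HasMaj (bHX ε) (BlockNorm.ofBlocks (toB6 g R H) 𝔬.blk) (𝔡.Dd U ν ∘ₗ (𝔬.Gp U ∘ₗ 𝔡.Dsd U μ))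
        (fun (a b : g.Site) => inputConst44 d₁ δ₁ α₁ NI N' C L₀ (BI ε) (θI ε) * Real.exp (-((1 - α) * δ * g.dist a b)))) ∧
      (∀ ε β : ℝ, 0 < ε → ε ≤ 1 → 0 ≤ β → β < 1 →
        HasMaj (bHX (β + ε)) (BlockNorm.ofBlocks (toB6 g R H) 𝔭.blkPX) (𝔭.ΦX U β ∘ₗ (𝔡.Dd U ν ∘ₗ (𝔬.Gp U ∘ₗ 𝔡.Dsd U μ)))
          (fun (a b : g.Site) => inputConst45 d₁ δ₁ α₁ NI N' L₀ (hc β) (BI2 ε β) (θI (β + ε)) * g.len a ^ (-β) *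
            Real.exp (-((1 - α) * δ * g.dist a b)))) := by
  have hlen0 : ∀ y : g.Site, 0 ≤ g.len y := fun y => (hs.lenpos y).le
  have htri : Triangle254 (toB6 g R H) := fun a b c => hs.tri a b c
  have hc1 : 0 ≤ B6.c1 d₁ δ₁ α₁ := c1_nonneg d₁ δ₁ α₁
  have hL₀ : 0 ≤ L₀ := le_trans (le_trans zero_le_one hF.one_le_L) hF.L_le
  have hαδ₁ : 0 ≤ α₁ * δ₁ := mul_nonneg hα₁ hδ₁
  have hrate : (1 - α) * δ ≤ (1 - α₁) * δ₁ := by nlinarith [hαδ, hδle]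
  have hexp : ∀ a b : g.Site, Real.exp (-(δ₁ * g.dist a b)) ≤ Real.exp (-((1 - α) * δ * g.dist a b)) := fun a b =>
    Real.exp_le_exp.mpr (neg_le_neg (mul_le_mul_of_nonneg_right (by nlinarith [hrate, hαδ₁]) (hs.dnn a b)))
  have hfix : 𝔬.Gp U = (∑ i, mulOp (𝔬.h i) * 𝔬.Gsq U i * mulOp (𝔬.h i)) +
      𝔬.Gp U * ∑ i, (𝔬.P U i ∘ₗ 𝔬.D U + 𝔬.Cop U i) * 𝔬.Gsq U i * mulOp (𝔬.h i) :=
    fixedPoint_of_388 hi.inv hi.eq388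
  refine ⟨fun ε hε0 hε1 => ?_, fun ε β hε0 hε1 hβ0 hβ1 => ?_⟩
  · have hθ : 0 ≤ θI ε := hθI ε hε0
    have hP := factorsPair37_sum hFI hε0 hθ hlen0 hs.cnt' μ
    have hS : HasMajorantHom (g := toB6 g R H) 𝔬.blk 𝔬.blk (𝔡.Dd U ν ∘ₗ 𝔬.Gp U)
        (fun (a b : g.Site) => C * (g.len a ^ (0 : ℝ) * g.len a) * Real.exp (-(δ * g.dist a b))) :=
      hasMajorantHom_mono (g := toB6 g R H) 𝔬.blk 𝔬.blk (hDS.left _ h1 ν) fun a b => le_of_eq (by rw [Real.rpow_zero, one_mul])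
    have htail := tail_comp (bHX ε) 𝔬.blk 𝔬.blk hF h261 htri hs.symm hs.dnn hs.lenpos hC (mul_nonneg hN' hθ) hαδ1 hrate hS hP
    have hhead := hasMaj_localSum (G := toB6 g R H)
      (fun i => 𝔡.Dd U ν ∘ₗ ((mulOp (𝔬.h i) * 𝔬.Gsq U i * mulOp (𝔬.h i)) ∘ₗ 𝔡.Dsd U μ))
      (fun i (a : g.Site) => if a ∈ SI i then (1 : ℝ) else 0)
      (fun (a b : g.Site) => BI ε * Real.exp (-(δ₁ * g.dist a b))) NI
      (fun a b => mul_nonneg (hBI ε hε0 hε1) (Real.exp_nonneg _)) (fun i => hIL.e4 ε hε0 hε1 i ν μ) hcntI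
    rw [sandwich_split' hfix, comp_sum_comp']
    refine (hhead.add htail).mono fun a b => ?_
    have hK0 : 0 ≤ NI * BI ε := mul_nonneg hNI (hBI ε hε0 hε1)
    calc NI * (BI ε * Real.exp (-(δ₁ * g.dist a b))) +
          C * (N' * θI ε) * L₀ * B6.c1 d₁ δ₁ α₁ * g.len a ^ (0 : ℝ) * Real.exp (-((1 - α) * δ * g.dist a b))
        = NI * BI ε * Real.exp (-(δ₁ * g.dist a b)) +
          C * (N' * θI ε) * L₀ * B6.c1 d₁ δ₁ α₁ * Real.exp (-((1 - α) * δ * g.dist a b)) := by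
          rw [Real.rpow_zero]; ring
      _ ≤ NI * BI ε * Real.exp (-((1 - α) * δ * g.dist a b)) +
          C * (N' * θI ε) * L₀ * B6.c1 d₁ δ₁ α₁ * Real.exp (-((1 - α) * δ * g.dist a b)) :=
          add_le_add (mul_le_mul_of_nonneg_left (hexp a b) hK0) le_rfl
      _ = inputConst44 d₁ δ₁ α₁ NI N' C L₀ (BI ε) (θI ε) * Real.exp (-((1 - α) * δ * g.dist a b)) := by
          unfold inputConst44; ring
  · have hβε : 0 < β + ε := by linarith
    have hθ : 0 ≤ θI (β + ε) := hθI (β + ε) hβε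
    have hP := factorsPair37_sum hFI hβε hθ hlen0 hs.cnt' μ
    have hHK : 0 ≤ hc β := hhc β hβ0 hβ1
    have hS : HasMajorantHom (g := toB6 g R H) 𝔬.blk 𝔭.blkPX ((𝔭.ΦX U β ∘ₗ 𝔡.Dd U ν) ∘ₗ 𝔬.Gp U)
        (fun (a b : g.Site) => hc β * (g.len a ^ (-β) * g.len a) * Real.exp (-(δ * g.dist a b))) := by
      refine hasMajorantHom_mono (g := toB6 g R H) 𝔬.blk 𝔭.blkPX (hDH.probe β _ (hHol β hβ0 hβ1) ν) fun a b => le_of_eq ?_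
      have hr : g.len a ^ (1 - β) = g.len a ^ (-β) * g.len a := by
        rw [show (1 - β : ℝ) = -β + 1 by ring, Real.rpow_add (hs.lenpos a), Real.rpow_one]
      rw [hr]
    have htail := tail_comp (bHX (β + ε)) 𝔬.blk 𝔭.blkPX hF h261 htri hs.symm hs.dnn hs.lenpos hHK (mul_nonneg hN' hθ) hαδ1
      hrate hS hP
    have hhead := hasMaj_localSum (G := toB6 g R H)
      (fun i => (𝔭.ΦX U β ∘ₗ 𝔡.Dd U ν) ∘ₗ ((mulOp (𝔬.h i) * 𝔬.Gsq U i * mulOp (𝔬.h i)) ∘ₗ 𝔡.Dsd U μ))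
      (fun i (a : g.Site) => if a ∈ SI i then (1 : ℝ) else 0)
      (fun (a b : g.Site) => BI2 ε β * g.len a ^ (-β) * Real.exp (-(δ₁ * g.dist a b))) NI
      (fun a b => mul_nonneg (mul_nonneg (hBI2 ε β hε0 hε1 hβ0 hβ1) (Real.rpow_nonneg (hlen0 a) _)) (Real.exp_nonneg _))
      (fun i => hIL.h2 ε β hε0 hε1 hβ0 hβ1 i ν μ) hcntI
    have hassoc : 𝔭.ΦX U β ∘ₗ (𝔡.Dd U ν ∘ₗ (𝔬.Gp U ∘ₗ 𝔡.Dsd U μ)) = (𝔭.ΦX U β ∘ₗ 𝔡.Dd U ν) ∘ₗ (𝔬.Gp U ∘ₗ 𝔡.Dsd U μ) := by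
      rw [LinearMap.comp_assoc]
    rw [hassoc, sandwich_split' hfix, comp_sum_comp']
    refine (hhead.add htail).mono fun a b => ?_
    have hW : 0 ≤ g.len a ^ (-β) := Real.rpow_nonneg (hlen0 a) _
    have hK0 : 0 ≤ NI * BI2 ε β * g.len a ^ (-β) := mul_nonneg (mul_nonneg hNI (hBI2 ε β hε0 hε1 hβ0 hβ1)) hW
    calc NI * (BI2 ε β * g.len a ^ (-β) * Real.exp (-(δ₁ * g.dist a b))) +
          hc β * (N' * θI (β + ε)) * L₀ * B6.c1 d₁ δ₁ α₁ * g.len a ^ (-β) * Real.exp (-((1 - α) * δ * g.dist a b))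
        = NI * BI2 ε β * g.len a ^ (-β) * Real.exp (-(δ₁ * g.dist a b)) +
          hc β * (N' * θI (β + ε)) * L₀ * B6.c1 d₁ δ₁ α₁ * (g.len a ^ (-β) * Real.exp (-((1 - α) * δ * g.dist a b))) := by ring
      _ ≤ NI * BI2 ε β * g.len a ^ (-β) * Real.exp (-((1 - α) * δ * g.dist a b)) +
          hc β * (N' * θI (β + ε)) * L₀ * B6.c1 d₁ δ₁ α₁ * (g.len a ^ (-β) * Real.exp (-((1 - α) * δ * g.dist a b))) :=
          add_le_add (mul_le_mul_of_nonneg_left (hexp a b) hK0) le_rfl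
      _ = inputConst45 d₁ δ₁ α₁ NI N' L₀ (hc β) (BI2 ε β) (θI (β + ε)) * g.len a ^ (-β) *
            Real.exp (-((1 - α) * δ * g.dist a b)) := by
          unfold inputConst45; ring

variable [Fintype P]

/-- ★ **THE PACKAGED FAMILY ∇_{U,ν}G′∇\*_{U,μ} OVER P × P HAS THE SAME (3.44)∕(3.45) MAJORANTS** (G′ twin of `inputPair3445_family`).
[cite: Balaban1985BackgroundPropagators, (3.44)–(3.45) p.398 + (3.39) p.397] -/
theorem inputPair3445_family_37 [Fintype X] [DecidableEq X] [Fintype Y] [Fintype ι] [Fintype PX] [Fintype PY]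
    (𝔬 : Ops g B X Y ι) (𝔡 : DirOps37 𝔬 P) (𝔭 : HolderProbes g B X Y PX PY) (R : ℝ) (H : Prop)
    (bHX : ℝ → BlockNorm (toB6 g R H) (X → ℝ)) (d d₁ : ℕ) (δ α L₀ δ₁ α₁ ρ N N' Cℓ NI C : ℝ) (κ : Sizes)
    (SI : ι → Finset g.Site) (hc BI θI : ℝ → ℝ) (BI2 : ℝ → ℝ → ℝ) (U : B.Cfg)
    (hδ₁ : 0 ≤ δ₁) (hα₁ : 0 ≤ α₁) (hN' : 0 ≤ N') (hNI : 0 ≤ NI) (hC : 0 ≤ C)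
    (hδle : δ ≤ (1 - α₁) * δ₁) (hαδ : 0 ≤ α * δ) (hαδ1 : α * δ ≤ δ)
    (hs : StaticOK 𝔬 ρ N N' Cℓ κ) (hcntI : ∀ a : g.Site, (∑ i, if a ∈ SI i then (1 : ℝ) else 0) ≤ NI)
    (hhc : ∀ β, 0 ≤ β → β < 1 → 0 ≤ hc β) (hBI : ∀ ε, 0 < ε → ε ≤ 1 → 0 ≤ BI ε)
    (hBI2 : ∀ ε β, 0 < ε → ε ≤ 1 → 0 ≤ β → β < 1 → 0 ≤ BI2 ε β) (hθI : ∀ ε, 0 < ε → 0 ≤ θI ε)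
    (h261 : Ineq261 d₁ (toB6 g R H) δ₁ α₁) (hF : Facts347 g R H d δ α L₀) (hi : Identities 𝔬 R H U)
    (hIL : InputLegsPair37 𝔬 𝔡 𝔭 R H bHX SI BI BI2 δ₁ U) (hFI : FactorsInputPair37 𝔬 𝔡 R H bHX θI δ₁ U)
    (hDS : DirSup37 𝔬 𝔡 R H U) (hDH : DirSupHolder37 𝔬 𝔡 𝔭 R H U)
    (h1 : HasMajorantHom (g := toB6 g R H) 𝔬.blk 𝔬.blkY (𝔬.D U ∘ₗ 𝔬.Gp U)
      (fun (a b : g.Site) => C * g.len a * Real.exp (-(δ * g.dist a b))))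
    (hHol : ∀ β : ℝ, 0 ≤ β → β < 1 → HasMajorantHom (g := toB6 g R H) 𝔬.blk 𝔭.blkPY ((𝔭.ΦY U β ∘ₗ 𝔬.D U) ∘ₗ 𝔬.Gp U)
      (fun (a b : g.Site) => hc β * g.len a ^ (1 - β) * Real.exp (-(δ * g.dist a b)))) :
    (∀ ε : ℝ, 0 < ε → ε ≤ 1 → HasMaj (bHX ε) (BlockNorm.ofBlocks (toB6 g R H) (𝔬.blk ∘ Prod.fst))
        (familyOp fun p : P × P => 𝔡.Dd U p.1 ∘ₗ (𝔬.Gp U ∘ₗ 𝔡.Dsd U p.2))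
        (fun (a b : g.Site) => inputConst44 d₁ δ₁ α₁ NI N' C L₀ (BI ε) (θI ε) * Real.exp (-((1 - α) * δ * g.dist a b)))) ∧
      (∀ ε β : ℝ, 0 < ε → ε ≤ 1 → 0 ≤ β → β < 1 →
        HasMaj (bHX (β + ε)) (BlockNorm.ofBlocks (toB6 g R H) (𝔭.blkPX ∘ Prod.fst))
          (sliceProbe (𝔭.ΦX U β) ∘ₗ familyOp fun p : P × P => 𝔡.Dd U p.1 ∘ₗ (𝔬.Gp U ∘ₗ 𝔡.Dsd U p.2))
          (fun (a b : g.Site) => inputConst45 d₁ δ₁ α₁ NI N' L₀ (hc β) (BI2 ε β) (θI (β + ε)) * g.len a ^ (-β) *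
            Real.exp (-((1 - α) * δ * g.dist a b)))) := by
  have hL₀ : 0 ≤ L₀ := le_trans (le_trans zero_le_one hF.one_le_L) hF.L_le
  have hc1 : 0 ≤ B6.c1 d₁ δ₁ α₁ := c1_nonneg d₁ δ₁ α₁
  have hlen0 : ∀ y : g.Site, 0 ≤ g.len y := fun y => (hs.lenpos y).le
  have hpair := fun p : P × P => inputPair3445_of_local37 𝔬 𝔡 𝔭 R H bHX d d₁ δ α L₀ δ₁ α₁ ρ N N' Cℓ NI C κ SI hc BI θI BI2 U
    hδ₁ hα₁ hN' hNI hC hδle hαδ hαδ1 hs hcntI hhc hBI hBI2 hθI h261 hF hi hIL hFI hDS hDH h1 hHol p.1 p.2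
  refine ⟨fun ε hε0 hε1 => ?_, fun ε β hε0 hε1 hβ0 hβ1 => ?_⟩
  · have hK : ∀ a b : g.Site, 0 ≤ inputConst44 d₁ δ₁ α₁ NI N' C L₀ (BI ε) (θI ε) * Real.exp (-((1 - α) * δ * g.dist a b)) := by
      intro a b
      have h1' := hBI ε hε0 hε1
      have h2' := hθI ε hε0
      unfold inputConst44
      positivity
    exact hasMaj_familyOp' (R := R) (H := H) 𝔬.blk hK fun p => (hpair p).1 ε hε0 hε1
  · have hK : ∀ a b : g.Site, 0 ≤ inputConst45 d₁ δ₁ α₁ NI N' L₀ (hc β) (BI2 ε β) (θI (β + ε)) * g.len a ^ (-β) *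
        Real.exp (-((1 - α) * δ * g.dist a b)) := by
      intro a b
      have h1' := hBI2 ε β hε0 hε1 hβ0 hβ1
      have h2' := hθI (β + ε) (by linarith)
      have h3' := hhc β hβ0 hβ1
      have h4' : 0 ≤ g.len a ^ (-β) := Real.rpow_nonneg (hlen0 a) _
      unfold inputConst45
      positivity
    rw [sliceProbe_comp_familyOp]
    exact hasMaj_familyOp' (R := R) (H := H) 𝔭.blkPX hK fun p => (hpair p).2 ε β hε0 hε1 hβ0 hβ1

end GpSide

end

end Literature.MathematicalPhysics.QuantumFieldTheory.Balaban1983to89.B9RWSums344InputPair
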